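/-
Copyright: public-domain mathematics; typed transcription for the H21 Literature library (cell lit-balaban,
Phase-2 proof seat p16 gen 6 = literature-prover-lit-balaban-p16-g6-0).

statement-level skeleton of published theorems with citation tags; proofs where landed; nothing here is a claim about the Yang–Mills mass gap

# Bałaban, *Propagators and renormalization transformations for lattice gauge theories. I*,
# Commun. Math. Phys. **95** (1984) 17–40 — «Δ′_a = Δ + aQ′_k*Q′_k … its inverse is a bounded operator G′_k» (p. 25, the sentence
# after (1.42)): `Δ + aQ′*Q′` IS INVERTIBLE on the product torus `T_η = Π_μ ℤ/(nM_μ)` for `a > 0`, and r02's `K_T`-vector IS `G′Q′*ω`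
# (the P-bridge, step (a))

[cite: Balaban1984PropagatorsI]  T. Bałaban, Commun. Math. Phys. 95 (1984) 17–40.  PDF held: `paper:balaban1984-cmp95-propagators-rt-i`
(journal page = PDF page + 16).  p. 25 [PDF 9] ll. 21–24: the integral display (1.42) (a `λ`-integral representation of (1.24)
with `Δ′_a` in the exponent; its integrand is NOT reproduced here), followed, verbatim, by «with a > 0 (we will take eventually a = 1),
and let us denote Δ′_a = Δ + aQ′_k*Q′_k = Δ + aP′_k. The properties of this operator were investigated in [2], its inverse is a
bounded operator G′_k with good regularity properties described in Theorem of [2].»  So `G′_k = (Δ + aQ′_k*Q′_k)⁻¹` is OUR READING of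
that sentence (on the finite torus: the matrix inverse), and the constant is a plain `a` (no `a_k` is printed).  Sect. C p. 22 [PDF 6] l. 7: «on the subspace orthogonal to constant functions the
operator Δ is positive».  p. 38 [PDF 22]: «the representation P = G′Q′*(Q′G′²Q′*)⁻¹Q′G′».  (v1.1/v1.2: header and citation tags re-quoted
at referee ref-1 g36's / second reader r05 g11's request — v1 presented the reading `G′_k = (Δ + a_kQ′_k*Q′_k)⁻¹` and a paraphrase of
the parenthesis as if printed; v1.1 transcribed the integrand of (1.42) from the text layer, which the page render does not support
(r05: the exponent carries `1/2α`), so v1.2 quotes only the prose.  No declaration changed.)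

WHAT THIS MODULE ADDS (SKELETON row B5.Prop1.2, census (vii) / r02 DESIGN-MEMO step (a); consumers: the P-bridge files
`B5PBridgeProjection` / `B5PBridgeKernel126` of this seat, p37's (vi)-G files, r02's (1.132) assembly):
* `form_greenOp` — the quadratic form of `Δ + aQ′*Q′` is `⟨f,Δf⟩ + a·n^d·‖Q′f‖²`;
* `greenOp_mulVec_injective` / **`isUnit_greenOp`** — for `a > 0` the operator `Δ′_a = Δ + aQ′*Q′` of p. 25 is invertible on ALL of
  `L²(T_η)` (a zero vector is constant by `B5LaplaceSpectral`, and `Q′` of a constant is that constant): `G′ := (Δ + aQ′*Q′)⁻¹`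
  is an honest matrix inverse (any dimension `d`, any `n ≥ 1`, `M_μ ≥ 1`);
* `greenOp_isHermitian` / `greenInv_isHermitian`, `greenOp_one` / `greenInv_one` (`G′1 = a⁻¹·1`);
* **`KTvec_eq_greenInv_mulVec`** — r02's `B5GreenBridgeP12Green.KTvec n M a ω = G′ *ᵥ (Q′* ω)` (dimension `d + 1`, the
  carrier of b04's kernel `K_T`): the sentence «Injectivity of Δ + aQ′*Q′, a > 0, hence KTvec = G′Q′*, is next» of that
  module's header, DONE.

HONEST SCOPE.  Finite-dimensional linear algebra over LANDED kernel facts (`B5LaplaceSpectral`, `B5Substitution125`,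
`B5GreenBridgeP12Green.green_KTvec`); no analysis.  Not summit progress.
-/
import Mathlib
import Literature.MathematicalPhysics.QuantumFieldTheory.Balaban1983to89.B5GreenBridgeP12Green
import Literature.MathematicalPhysics.QuantumFieldTheory.Balaban1983to89.B5LaplaceSpectral
import Literature.MathematicalPhysics.QuantumFieldTheory.Balaban1983to89.B5Substitution125

open scoped BigOperators Matrix ComplexConjugate ComplexOrder
open Finset Matrix

namespace Literature.MathematicalPhysics.QuantumFieldTheory.Balaban1983to89.B5PBridgeGreenInverse

open Literature.MathematicalPhysics.QuantumFieldTheory.Balaban1983to89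
open Literature.MathematicalPhysics.QuantumFieldTheory.Balaban1983to89.B5Prop11Plancherel (Tor fine)
open Literature.MathematicalPhysics.QuantumFieldTheory.Balaban1983to89.B5Action121 (LapS GradOp form_gram_rect
  form_grad_eq_form_LapS)
open Literature.MathematicalPhysics.QuantumFieldTheory.Balaban1983to89.B5Block118 (QsOp)
open Literature.MathematicalPhysics.QuantumFieldTheory.Balaban1983to89.B5Hk160Torus (QsAdj)
open Literature.MathematicalPhysics.QuantumFieldTheory.Balaban1983to89.B5LaplaceSpectral (LapS_isHermitian form_LapS_nonneg
  sdiff_eq_zero_of_form const_of_sdiff_eq_zero)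
open Literature.MathematicalPhysics.QuantumFieldTheory.Balaban1983to89.B5Substitution125 (QsOp_const)
open Literature.MathematicalPhysics.QuantumFieldTheory.Balaban1983to89.B5GreenBridgeP12Dict (QsAdj_mulVec)
open Literature.MathematicalPhysics.QuantumFieldTheory.Balaban1983to89.B5GreenBridgeP12Green (KTvec green_KTvec)

noncomputable section

/-! ## §1 `Δ + aQ′*Q′` is positive definite for `a > 0` (any dimension) -/

section AnyDim

variable {d : ℕ} (n : ℕ) [NeZero n] (M : Fin d → ℕ) [hM : ∀ μ, NeZero (M μ)]

omit [NeZero n] hM in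
/-- `Q′*Q′ = n^d · Q′ᴴQ′` (the weighted adjoint (1.21)). [cite: Balaban1984PropagatorsI, (1.21) p.21] -/
theorem QsAdj_mul_QsOp [hM : ∀ μ, NeZero (M μ)] : QsAdj n M * QsOp n M = ((n : ℂ) ^ d) • ((QsOp n M)ᴴ * QsOp n M) := by
  rw [QsAdj, Matrix.smul_mul]

/-- the quadratic form of `Δ′_a = Δ + aQ′*Q′` (p. 25): `⟨f, (Δ + aQ′*Q′)f⟩ = ⟨f, Δf⟩ + a n^d ⟨Q′f, Q′f⟩`.
[cite: Balaban1984PropagatorsI, p.25 (after (1.42): Δ′_a = Δ + aQ′_k*Q′_k), (1.21) p.21] -/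
theorem form_greenOp (a : ℝ) (f : Tor (fine n M) → ℂ) :
    star f ⬝ᵥ ((LapS (fine n M) (n : ℂ) + (a : ℂ) • (QsAdj n M * QsOp n M)) *ᵥ f)
      = star f ⬝ᵥ (LapS (fine n M) (n : ℂ) *ᵥ f) + (a : ℂ) * (n : ℂ) ^ d * (star (QsOp n M *ᵥ f) ⬝ᵥ (QsOp n M *ᵥ f)) := by
  rw [Matrix.add_mulVec, dotProduct_add, QsAdj_mul_QsOp, smul_smul, Matrix.smul_mulVec, dotProduct_smul,
    form_gram_rect, smul_eq_mul, mul_assoc]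

omit hM in
/-- «Δ … a > 0»: `(Δ + aQ′*Q′)f = 0 ⟹ f = 0` — `⟨f,Δf⟩ = 0` makes `f` constant (Sect. C), `Q′f = 0` kills the constant.
[cite: Balaban1984PropagatorsI, p.25 (after (1.42)), Sect. C p.22] -/
theorem greenOp_eq_zero [hM : ∀ μ, NeZero (M μ)] {a : ℝ} (ha : 0 < a) (f : Tor (fine n M) → ℂ)
    (h : (LapS (fine n M) (n : ℂ) + (a : ℂ) • (QsAdj n M * QsOp n M)) *ᵥ f = 0) : f = 0 := by
  have hc : (n : ℂ) ≠ 0 := Nat.cast_ne_zero.mpr (NeZero.ne n)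
  have hform := congrArg (fun v => star f ⬝ᵥ v) h
  simp only [dotProduct_zero] at hform
  rw [form_greenOp] at hform
  have h1 : 0 ≤ star f ⬝ᵥ (LapS (fine n M) (n : ℂ) *ᵥ f) := form_LapS_nonneg (fine n M) (n : ℂ) f
  have han : (0 : ℂ) ≤ (a : ℂ) * (n : ℂ) ^ d := by
    have : (0 : ℝ) ≤ a * (n : ℝ) ^ d := by positivity
    exact_mod_cast this
  have h2 : 0 ≤ (a : ℂ) * (n : ℂ) ^ d * (star (QsOp n M *ᵥ f) ⬝ᵥ (QsOp n M *ᵥ f)) :=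
    mul_nonneg han (dotProduct_star_self_nonneg _)
  obtain ⟨hL, hQ⟩ := (add_eq_zero_iff_of_nonneg h1 h2).mp hform
  -- `f` is constant
  have hconst : ∀ x, f x = f 0 := fun x =>
    const_of_sdiff_eq_zero (fine n M) hc f (sdiff_eq_zero_of_form (fine n M) (n : ℂ) f hL) x
  have hf : f = fun _ => f 0 := funext hconst
  -- `Q′f = 0`
  have han' : (a : ℂ) * (n : ℂ) ^ d ≠ 0 :=
    mul_ne_zero (by exact_mod_cast ha.ne') (pow_ne_zero _ hc)
  have hQ0 : QsOp n M *ᵥ f = 0 := by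
    have := (mul_eq_zero.mp hQ).resolve_left han'
    exact dotProduct_star_self_eq_zero.mp this
  rw [hf, QsOp_const] at hQ0
  have h0 : f 0 = 0 := congrFun hQ0 (0 : Tor M)
  rw [hf, h0]
  rfl

omit hM in
/-- `Δ + aQ′*Q′` acts injectively (`a > 0`). [cite: Balaban1984PropagatorsI, p.25 (after (1.42): «Δ′_a = Δ + aQ′_k*Q′_k … its inverse is a bounded operator G′_k»)] -/
theorem greenOp_mulVec_injective [hM : ∀ μ, NeZero (M μ)] {a : ℝ} (ha : 0 < a) :
    Function.Injective (LapS (fine n M) (n : ℂ) + (a : ℂ) • (QsAdj n M * QsOp n M)).mulVec := by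
  intro f g hfg
  have h : (LapS (fine n M) (n : ℂ) + (a : ℂ) • (QsAdj n M * QsOp n M)) *ᵥ (f - g) = 0 := by
    rw [Matrix.mulVec_sub, hfg, sub_self]
  exact sub_eq_zero.mp (greenOp_eq_zero n M ha _ h)

omit hM in
/-- **«its inverse is a bounded operator G′_k» (p. 25): `G′ = (Δ + aQ′*Q′)⁻¹` EXISTS** — the matrix `Δ + aQ′*Q′` is a unit for `a > 0`.
[cite: Balaban1984PropagatorsI, p.25 (after (1.42): «Δ′_a = Δ + aQ′_k*Q′_k … its inverse is a bounded operator G′_k»)] -/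
theorem isUnit_greenOp [hM : ∀ μ, NeZero (M μ)] {a : ℝ} (ha : 0 < a) :
    IsUnit (LapS (fine n M) (n : ℂ) + (a : ℂ) • (QsAdj n M * QsOp n M)) :=
  (Matrix.mulVec_injective_iff_isUnit).mp (greenOp_mulVec_injective n M ha)

omit hM in
/-- `G′⁻¹·G′ = 1`. [cite: Balaban1984PropagatorsI, p.25 (after (1.42): «Δ′_a = Δ + aQ′_k*Q′_k … its inverse is a bounded operator G′_k»)] -/
theorem greenOp_mul_inv [hM : ∀ μ, NeZero (M μ)] {a : ℝ} (ha : 0 < a) :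
    (LapS (fine n M) (n : ℂ) + (a : ℂ) • (QsAdj n M * QsOp n M))
      * (LapS (fine n M) (n : ℂ) + (a : ℂ) • (QsAdj n M * QsOp n M))⁻¹ = 1 :=
  Matrix.mul_nonsing_inv _ ((Matrix.isUnit_iff_isUnit_det _).mp (isUnit_greenOp n M ha))

omit hM in
/-- `G′·G′⁻¹ = 1`. [cite: Balaban1984PropagatorsI, p.25 (after (1.42): «Δ′_a = Δ + aQ′_k*Q′_k … its inverse is a bounded operator G′_k»)] -/
theorem inv_mul_greenOp [hM : ∀ μ, NeZero (M μ)] {a : ℝ} (ha : 0 < a) :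
    (LapS (fine n M) (n : ℂ) + (a : ℂ) • (QsAdj n M * QsOp n M))⁻¹
      * (LapS (fine n M) (n : ℂ) + (a : ℂ) • (QsAdj n M * QsOp n M)) = 1 :=
  Matrix.nonsing_inv_mul _ ((Matrix.isUnit_iff_isUnit_det _).mp (isUnit_greenOp n M ha))

omit [NeZero n] hM in
/-- `(Q′*)ᴴ = n^d · Q′`. [cite: Balaban1984PropagatorsI, (1.21) p.21] -/
theorem QsAdj_conjTranspose : (QsAdj n M)ᴴ = ((n : ℂ) ^ d) • QsOp n M := by
  rw [QsAdj, Matrix.conjTranspose_smul, Matrix.conjTranspose_conjTranspose]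
  congr 1
  simp

/-- `Δ + aQ′*Q′` is Hermitian (`a` real). [cite: Balaban1984PropagatorsI, p.25 (after (1.42): «Δ′_a = Δ + aQ′_k*Q′_k … its inverse is a bounded operator G′_k»)] -/
theorem greenOp_isHermitian (a : ℝ) :
    (LapS (fine n M) (n : ℂ) + (a : ℂ) • (QsAdj n M * QsOp n M)).IsHermitian := by
  unfold Matrix.IsHermitian
  rw [Matrix.conjTranspose_add, (LapS_isHermitian (fine n M) (n : ℂ)).eq, Matrix.conjTranspose_smul,
    Matrix.conjTranspose_mul, QsAdj_conjTranspose, Matrix.mul_smul, QsAdj, Matrix.smul_mul, Complex.star_def,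
    Complex.conj_ofReal]

omit hM in
/-- `G′` is Hermitian. [cite: Balaban1984PropagatorsI, p.25 (after (1.42): «Δ′_a = Δ + aQ′_k*Q′_k … its inverse is a bounded operator G′_k»)] -/
theorem greenInv_isHermitian [hM : ∀ μ, NeZero (M μ)] (a : ℝ) :
    ((LapS (fine n M) (n : ℂ) + (a : ℂ) • (QsAdj n M * QsOp n M))⁻¹).IsHermitian :=
  (greenOp_isHermitian n M a).inv

/-- `(Δ + aQ′*Q′)1 = a·1` («Q′ of a constant is that constant, Q′*a = η^d… a» p. 22, and `Δ1 = 0`).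
[cite: Balaban1984PropagatorsI, Sect. C p.22, p.25 (after (1.42))] -/
theorem greenOp_one (a : ℝ) :
    (LapS (fine n M) (n : ℂ) + (a : ℂ) • (QsAdj n M * QsOp n M)) *ᵥ (fun _ => (1 : ℂ)) = fun _ => (a : ℂ) := by
  rw [Matrix.add_mulVec, B5LaplaceSpectral.LapS_const, zero_add, Matrix.smul_mulVec, ← Matrix.mulVec_mulVec,
    QsOp_const]
  funext x
  rw [Pi.smul_apply, QsAdj_mulVec, smul_eq_mul, mul_one]

omit hM in
/-- `G′1 = a⁻¹·1`. [cite: Balaban1984PropagatorsI, p.25 (after (1.42): «Δ′_a = Δ + aQ′_k*Q′_k … its inverse is a bounded operator G′_k»)] -/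
theorem greenInv_one [hM : ∀ μ, NeZero (M μ)] {a : ℝ} (ha : 0 < a) :
    (LapS (fine n M) (n : ℂ) + (a : ℂ) • (QsAdj n M * QsOp n M))⁻¹ *ᵥ (fun _ => (1 : ℂ))
      = fun _ => ((a : ℂ))⁻¹ := by
  have ha' : (a : ℂ) ≠ 0 := by exact_mod_cast ha.ne'
  have h1 : (fun _ : Tor (fine n M) => (1 : ℂ)) = (a : ℂ)⁻¹ • (fun _ => (a : ℂ)) := by
    funext x; simp [ha']
  conv_lhs => rw [h1, ← greenOp_one n M a, Matrix.mulVec_smul, Matrix.mulVec_mulVec, inv_mul_greenOp n M ha,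
    Matrix.one_mulVec]
  funext x
  simp

end AnyDim

/-! ## §2 `KTvec = G′Q′*` (dimension `d + 1`, the carrier of b04's `K_T`) -/

section KT

variable {d : ℕ} (n : ℕ) [NeZero n] (M : Fin (d + 1) → ℕ) [hM : ∀ μ, NeZero (M μ)]

omit hM in
/-- **`K_Tω = G′Q′*ω`**: r02's kernel vector is the Green operator `G′` of p. 25 applied to `Q′*ω` — b04's Green identity
`green_KTvec` divided by the now-invertible `Δ + aQ′*Q′`. [cite: Balaban1984PropagatorsI, p.25 (after (1.42)), p.38 ll.7–10]
[cite: Balaban1983RegularityDecay, (2.44)/(2.48) pp.584–585] -/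
theorem KTvec_eq_greenInv_mulVec [hM : ∀ μ, NeZero (M μ)] (hn : 1 ≤ n) {a : ℝ} (ha : 0 < a) (ω : Tor M → ℂ) :
    KTvec n M a ω = (LapS (fine n M) (n : ℂ) + (a : ℂ) • (QsAdj n M * QsOp n M))⁻¹ *ᵥ (QsAdj n M *ᵥ ω) := by
  rw [← green_KTvec n M hn ha ω, Matrix.mulVec_mulVec, inv_mul_greenOp n M ha, Matrix.one_mulVec]

omit hM in
/-- `Q′G′Q′*`-form: `Q′(K_Tω) = Q′G′Q′*ω`. [cite: Balaban1984PropagatorsI, p.38 ll.7–10] -/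
theorem QsOp_KTvec [hM : ∀ μ, NeZero (M μ)] (hn : 1 ≤ n) {a : ℝ} (ha : 0 < a) (ω : Tor M → ℂ) :
    QsOp n M *ᵥ KTvec n M a ω
      = (QsOp n M * (LapS (fine n M) (n : ℂ) + (a : ℂ) • (QsAdj n M * QsOp n M))⁻¹ * QsAdj n M) *ᵥ ω := by
  rw [KTvec_eq_greenInv_mulVec n M hn ha, Matrix.mulVec_mulVec, Matrix.mulVec_mulVec, Matrix.mul_assoc]

end KT

end

end Literature.MathematicalPhysics.QuantumFieldTheory.Balaban1983to89.B5PBridgeGreenInverse
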